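import Summits.KontsevichZagierPeriods.KontsevichZagierPeriods.Theorems.RootDecompWalshStrataEulerDescent08

/-!
# Conic descent, gen 6 (L4 one-variable Euler descent `[T, R(x)·√(ex²+fx+g)^{±1}] ∈ InBaker`), part 9/12

Declarations `InBaker.rat_factor_mult` … `InBaker.moebius_factor'` of the farm-checked gen-6 monolith; see the module docstring of
`EulerDescent01` (part 1) for the overview, the design and the sources. [KontsevichZagier2001 §1.1–1.2; BCR1998 §2.2; Euler 1768; this node gen 4 `sqrtDescent_*`]
-/

noncomputable section

open Literature.NumberTheory.Transcendental
open MeasureTheory Set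
open MvPolynomial (aeval)
open Literature.ModelTheory.ExponentialFields (IsSemialgebraic isSemialgebraic_univ
  isSemialgebraic_setOf_eval_pos isSemialgebraic_setOf_eval_lt isSemialgebraic_setOf_eval_le
  isSemialgebraic_setOf_eval_nonneg isSemialgebraic_setOf_eval_eq_zero continuous_aeval_real
  tarski_seidenberg_real_holds)

namespace Summit.KontsevichZagierPeriods.RootDecompWalshStrata.ConicDescent
/-- The half-line `{t > 0}` is `ℚ`-semialgebraic (part-local `private` copy). [BCR1998 §2.2] -/
private theorem isSemialgebraic_pos' : IsSemialgebraic ℚ {v : Fin 1 → ℝ | 0 < v 0} := by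
  convert isSemialgebraic_setOf_eval_pos (k := ℚ) (R := ℝ) (MvPolynomial.X (0 : Fin 1) : MvPolynomial (Fin 1) ℚ) using 1
  ext v; simp
/-- **BOOKKEEPING WITH MULTIPLICITIES.** As `InBaker.rat_factor`, but the list of rational poles
may repeat a point (`#a` = the order of the pole at `a`); every pole of order `≥ 2`, and every
simple pole off the roots of `D`, must keep the distance `δ` from `T`. One step peels off the
FULL principal atom `c·√D/(x − a)^(#a)` (`simple_pole` / `root_pole_atom` / `pole_pow`) and lowers
the order at `a` by one: `N/((x − a)^m·M′) = c/(x − a)^m + Ñ/((x − a)^(m−1)·M′)`. Consequently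
`[T, R(x)·√D] ∈ InBaker` for EVERY `R ∈ ℚ(x)` whose denominator is (hull-clean)·(split over `ℚ`),
on any bounded `T` on which `R·√D` is a genuine (integrable) representation after finitely many
splits. [this node] -/
theorem InBaker.rat_factor_mult (e f g : ℚ) (he : e ≠ 0) (hh : g - f ^ 2 / (4 * e) ≠ 0)
    (Q₀ : Polynomial ℚ) (lo hi δ : ℚ) (hδ : 0 < δ)
    (hQ₀ : ∀ x : ℝ, (lo : ℝ) ≤ x → x ≤ hi →
      Polynomial.aeval x Q₀ ≠ 0 ∧ Polynomial.aeval (2 * (((-f / (2 * e) : ℚ) : ℝ)) - x) Q₀ ≠ 0)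
    (poles : List ℚ) (hQa : ∀ a ∈ poles, Q₀.eval a ≠ 0)
    (N : Polynomial ℚ) (r : KZ.IntegralRep 1)
    (hdom : ∀ v ∈ r.domain, (lo : ℝ) ≤ v 0 ∧ v 0 ≤ hi)
    (hsep : ∀ v ∈ r.domain, ∀ a ∈ poles, (e * a ^ 2 + f * a + g ≠ 0 ∨ 2 ≤ poles.count a) →
      (δ : ℝ) ≤ |v 0 - a|)
    (hr : EqOn r.integrand (fun v => Polynomial.aeval (v 0) N /
        (Polynomial.aeval (v 0) Q₀ * (poles.map fun a : ℚ => v 0 - (a : ℝ)).prod) *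
          √(qD e f g (v 0))) r.domain) :
    InBaker (KZ.of r) := by
  have hΔ := disc_ne_zero he hh
  have hδ' : (0 : ℝ) < δ := by exact_mod_cast hδ
  induction poles generalizing N r with
  | nil =>
    refine InBaker.euler_factor e f g he hh N Q₀ lo hi r hdom hQ₀ fun v hv => ?_
    rw [hr hv]
    simp only [List.map_nil, List.prod_nil, mul_one]
  | cons a rest ih =>
    refine InBaker.restrict_pos e f g r _ hr fun r₁ hsub hpos hr₁ => ?_
    have hTsub : ∀ v ∈ r₁.domain, (lo : ℝ) ≤ v 0 ∧ v 0 ≤ hi ∧ 0 < qD e f g (v 0) :=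
      fun v hv => ⟨(hdom v (hsub hv)).1, (hdom v (hsub hv)).2, hpos v hv⟩
    -- no pole lies on the (positive part of the) domain
    have hoff : ∀ v ∈ r₁.domain, ∀ b ∈ a :: rest, v 0 ≠ (b : ℝ) := by
      intro v hv b hb hvb
      by_cases hDb : e * b ^ 2 + f * b + g = 0
      · have hD := hpos v hv
        rw [hvb, qD] at hD
        have : (e : ℝ) * b ^ 2 + f * b + g = 0 := by exact_mod_cast hDb
        exact hD.ne' this
      · have h := hsep v (hsub hv) b hb (Or.inl hDb)
        rw [hvb, sub_self, abs_zero] at h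
        exact not_lt.2 h hδ'
    -- the order `m = #a` of the pole at `a`, the cofactor list `rest' = rest ∖ {a}`
    obtain ⟨rest', hrest'def⟩ : ∃ rest' : List ℚ, rest' = rest.filter fun b => b ≠ a := ⟨_, rfl⟩
    have hrest'a : a ∉ rest' := by rw [hrest'def]; simp
    have hrest'sub : ∀ b ∈ rest', b ∈ rest := fun b hb => by
      rw [hrest'def] at hb; exact List.mem_of_mem_filter hb
    obtain ⟨m', hm'def⟩ : ∃ m' : ℕ, m' = rest.count a := ⟨_, rfl⟩
    have hcount : (a :: rest).count a = m' + 1 := by rw [List.count_cons_self, hm'def]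
    have hprod₁ : ∀ x : ℝ, ((a :: rest).map fun b : ℚ => x - (b : ℝ)).prod =
        (x - a) ^ (m' + 1) * (rest'.map fun b : ℚ => x - (b : ℝ)).prod := fun x => by
      rw [prod_split_count (a :: rest) a x, hcount, hrest'def, List.filter_cons_of_neg (by simp)]
    have hprod₂ : ∀ x : ℝ, (rest.map fun b : ℚ => x - (b : ℝ)).prod =
        (x - a) ^ m' * (rest'.map fun b : ℚ => x - (b : ℝ)).prod := fun x => by
      rw [prod_split_count rest a x, hm'def, hrest'def]
    -- the partial-fraction step at `a` with `M′ = Q₀ · ∏_{rest'} (X − b)`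
    obtain ⟨c, Nt, hid⟩ := pf_step N (Q₀ * (rest'.map fun b => Polynomial.X - Polynomial.C b).prod) a
      (by rw [Polynomial.eval_mul]; exact mul_ne_zero (hQa a (by simp)) (eval_prodX_ne_zero rest' a hrest'a))
    -- is the principal atom `c·√D/(x − a)^(m'+1)` separated from `T`?
    have hsepA : (e * a ^ 2 + f * a + g ≠ 0 ∨ 1 ≤ m') → ∀ v ∈ r₁.domain, (δ : ℝ) ≤ |v 0 - a| :=
      fun hc v hv => hsep v (hsub hv) a (by simp)
        (hc.imp_right fun h1 => by rw [hcount]; omega)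
    -- the atom as a representation of its own
    have hSA : IsSemialgebraic ℚ r₁.domain := r₁.isSemialgebraic_domain
    obtain ⟨rA, hdomA, hintA⟩ : ∃ rA : KZ.IntegralRep 1, rA.domain = r₁.domain ∧
        rA.integrand = fun v => (c : ℝ) / (v 0 - a) ^ (m' + 1) * √(qD e f g (v 0)) := by
      by_cases hc : e * a ^ 2 + f * a + g ≠ 0 ∨ 1 ≤ m'
      · -- separated: `c√D/(x − a)^m = (c·D/(x − a)^m)/√D`, numerator bounded thanks to `δ`
        have hcontD : Continuous fun x : ℝ => qD e f g x := by unfold qD; fun_prop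
        obtain ⟨MD, hMD⟩ := (isCompact_Icc : IsCompact (Icc (lo : ℝ) hi)).exists_bound_of_continuousOn
          hcontD.continuousOn
        have hF : IsSemialgebraicFunOn ℚ r₁.domain
            fun v => (c : ℝ) * qD e f g (v 0) / (v 0 - a) ^ (m' + 1) :=
          (((IsRatOn.const c).mul (IsRatOn.quad e f g)).div
            ((IsRatOn.coord.sub (IsRatOn.const a)).pow (m' + 1))
            fun v hv => pow_ne_zero _ (sub_ne_zero.2 (hoff v hv a (by simp)))).isSemialgebraicFunOn hSA
        refine ⟨sqrtDivRep e f g hΔ lo hi r₁.domain hSA hTsub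
          (fun v => (c : ℝ) / (v 0 - a) ^ (m' + 1) * √(qD e f g (v 0))) _ hF
          (|(c : ℝ)| * |MD| / δ ^ (m' + 1))
          (fun v hv => ?_) (fun v hv => ?_), rfl, rfl⟩
        · have hxa : (δ : ℝ) ≤ |v 0 - a| := hsepA hc v hv
          have hD : |qD e f g (v 0)| ≤ |MD| :=
            ((Real.norm_eq_abs _).symm.le.trans (hMD (v 0) ⟨(hTsub v hv).1, (hTsub v hv).2.1⟩)).trans
              (le_abs_self MD)
          rw [abs_div, abs_mul, abs_pow]
          calc |(c : ℝ)| * |qD e f g (v 0)| / |v 0 - ↑a| ^ (m' + 1)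
              ≤ |(c : ℝ)| * |MD| / |v 0 - ↑a| ^ (m' + 1) :=
                div_le_div_of_nonneg_right (mul_le_mul_of_nonneg_left hD (abs_nonneg _))
                  (pow_nonneg (abs_nonneg _) _)
            _ ≤ |(c : ℝ)| * |MD| / δ ^ (m' + 1) :=
                div_le_div_of_nonneg_left (mul_nonneg (abs_nonneg _) (abs_nonneg _))
                  (pow_pos hδ' _) (pow_le_pow_left₀ hδ'.le hxa _)
        · have hD := hpos v hv
          have hs : √(qD e f g (v 0)) ≠ 0 := (Real.sqrt_pos.2 hD).ne'
          have hxa : v 0 - (a : ℝ) ≠ 0 := sub_ne_zero.2 (hoff v hv a (by simp))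
          rw [eq_div_iff hs, mul_assoc, Real.mul_self_sqrt hD.le]
          field_simp
      · -- a simple pole at a root: `c√D/(x − a) = c(e(x + a) + f)/√D`
        have hDa : e * a ^ 2 + f * a + g = 0 := by
          by_contra h; exact hc (Or.inl h)
        have hm'0 : m' = 0 := by omega
        have hcont : Continuous fun x : ℝ => (c : ℝ) * ((e : ℝ) * (x + a) + f) := by fun_prop
        obtain ⟨M, hM⟩ := (isCompact_Icc : IsCompact (Icc (lo : ℝ) hi)).exists_bound_of_continuousOn
          hcont.continuousOn
        have hF : IsSemialgebraicFunOn ℚ r₁.domain fun v => (c : ℝ) * ((e : ℝ) * (v 0 + a) + f) :=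
          ((IsRatOn.const c).mul (((IsRatOn.const e).mul (IsRatOn.coord.add (IsRatOn.const a))).add
            (IsRatOn.const f))).isSemialgebraicFunOn hSA
        refine ⟨sqrtDivRep e f g hΔ lo hi r₁.domain hSA hTsub
          (fun v => (c : ℝ) / (v 0 - a) ^ (m' + 1) * √(qD e f g (v 0))) _ hF M
          (fun v hv => by
            rw [← Real.norm_eq_abs]; exact hM (v 0) ⟨(hTsub v hv).1, (hTsub v hv).2.1⟩)
          (fun v hv => ?_), rfl, rfl⟩
        have hD := hpos v hv
        have hs : √(qD e f g (v 0)) ≠ 0 := (Real.sqrt_pos.2 hD).ne'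
        have hxa : v 0 - (a : ℝ) ≠ 0 := sub_ne_zero.2 (hoff v hv a (by simp))
        have hfac : qD e f g (v 0) = (v 0 - a) * ((e : ℝ) * (v 0 + a) + f) := by
          have : (e : ℝ) * a ^ 2 + f * a + g = 0 := by exact_mod_cast hDa
          simp only [qD]; linear_combination this
        rw [hm'0, zero_add, pow_one, eq_div_iff hs, mul_assoc, Real.mul_self_sqrt hD.le, hfac]
        field_simp
    -- the atom is in the Baker sector
    have hA : InBaker (KZ.of rA) := by
      rcases Nat.eq_zero_or_pos m' with hm'0 | hm'1
      · by_cases hDa : e * a ^ 2 + f * a + g = 0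
        · exact InBaker.root_pole_atom e f g a c he hh hDa rA fun v _ => by
            simp only [hintA, hm'0, zero_add, pow_one]
        · exact InBaker.simple_pole e f g a c he hh hDa lo hi rA
            (fun v hv => ⟨(hTsub v (hdomA ▸ hv)).1, (hTsub v (hdomA ▸ hv)).2.1⟩)
            fun v _ => by simp only [hintA, hm'0, zero_add, pow_one]
      · exact InBaker.pole_pow e f g a c he hh (m' + 1) (by omega) lo hi δ hδ rA
          (fun v hv => ⟨(hTsub v (hdomA ▸ hv)).1, (hTsub v (hdomA ▸ hv)).2.1⟩)
          (fun v hv => hsepA (Or.inr hm'1) v (hdomA ▸ hv)) fun v _ => by rw [hintA]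
    -- the rest is the difference representation, settled by induction (order at `a` lowered)
    refine InBaker.of_sub' r₁ rA hdomA hA (ih (fun b hb => hQa b (List.mem_cons_of_mem a hb)) Nt
      (subRep r₁ rA hdomA) (fun v hv => hdom v (hsub hv))
      (fun v hv b hb hDb => hsep v (hsub hv) b (List.mem_cons_of_mem a hb)
        (hDb.imp_right fun h2 => h2.trans List.count_le_count_cons))
      fun v hv => ?_)
    have hv' : v ∈ r₁.domain := hv
    have hxa : v 0 - (a : ℝ) ≠ 0 := sub_ne_zero.2 (hoff v hv' a (by simp))
    have hQ : Polynomial.aeval (v 0) Q₀ ≠ 0 := (hQ₀ (v 0) (hTsub v hv').1 (hTsub v hv').2.1).1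
    have hPr : (rest'.map fun b : ℚ => v 0 - (b : ℝ)).prod ≠ 0 :=
      list_prod_sub_ne_zero rest' (v 0) fun b hb =>
        hoff v hv' b (List.mem_cons_of_mem a (hrest'sub b hb))
    have hidv := hid (v 0)
    rw [map_mul, aeval_prodX] at hidv
    have hN : Polynomial.aeval (v 0) N = (v 0 - a) * Polynomial.aeval (v 0) Nt +
        c * (Polynomial.aeval (v 0) Q₀ * (rest'.map fun b : ℚ => v 0 - (b : ℝ)).prod) := by
      linear_combination -hidv
    rw [subRep_integrand, hintA, hr₁ hv']
    beta_reduce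
    rw [hprod₁, hprod₂, hN]
    field_simp
    ring

/-! #### 24.15 The Euler factor transported by a rational inversion (the Möbius dodge) -/

/-- **MÖBIUS-TRANSPORTED EULER FACTOR.** `[T, N(x)/Q(x)·√D] ∈ InBaker` on a domain inside
`[lo, hi]`, for any inversion centre `a ∈ ℚ`, `a < lo`, such that the REVERSED TAYLOR data
`Nt, Qt` at `a` (`N(x) = (x − a)^n·Nt(1/(x − a))`, `Q(x) = (x − a)^q·Qt(1/(x − a))`, `Qt(0) ≠ 0`)
is hull-clean for the INVERTED conic `D̃(z) = z²D(a + 1/z) = D(a)z² + D′(a)z + e` on the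
`z`-range `[1/(hi − a), 1/(lo − a)]`: `Qt(z) ≠ 0` and `Qt(2z̃₀ − z) ≠ 0` there,
`z̃₀ = −D′(a)/(2D(a))` (for `D(a) = 0` the radicand becomes LINEAR and only `Qt ≠ 0` is used).
After `x = a + 1/z` the integrand is `z^q·Nt(z)/(z^(n+3)·Qt(z))·√D̃(z)` and `rat_factor_mult`
(pole list `[0, …, 0]`) resp. `linear_factor` finishes.  THE POINT: the mirror involution of `D̃`
read in the coordinate `x` is `μ_a(θ) = (a²(eθ + f) + 2ga − gθ)/(−ea² + 2eaθ + fθ + g)`, which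
MOVES with `a` (`μ_∞(θ) = 2x₀ − θ` is the one `euler_factor` uses); an irrational pole `θ` of `R`
whose `μ_∞`-mirror meets the hull — the single configuration `euler_factor` excludes — is in
`μ_a`-mirror position only for the finitely many `a` solving `μ_a(θ) ∈` (endpoints), so on a short
enough piece of `T` some rational `a` makes this theorem applicable. [this node] -/
theorem InBaker.moebius_factor (e f g a : ℚ) (he : e ≠ 0) (hh : g - f ^ 2 / (4 * e) ≠ 0)
    (N Q Nt Qt : Polynomial ℚ) (n q : ℕ)
    (hN : ∀ x : ℝ, x ≠ a → Polynomial.aeval x N = (x - a) ^ n * Polynomial.aeval (x - a)⁻¹ Nt)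
    (hQ : ∀ x : ℝ, x ≠ a → Polynomial.aeval x Q = (x - a) ^ q * Polynomial.aeval (x - a)⁻¹ Qt)
    (hQt0 : Qt.eval 0 ≠ 0) (lo hi : ℚ) (halo : a < lo)
    (hQt : ∀ z : ℝ, ((1 / (hi - a) : ℚ) : ℝ) ≤ z → z ≤ ((1 / (lo - a) : ℚ) : ℝ) →
      Polynomial.aeval z Qt ≠ 0 ∧ (e * a ^ 2 + f * a + g ≠ 0 →
        Polynomial.aeval (2 * (((-(2 * e * a + f) / (2 * (e * a ^ 2 + f * a + g)) : ℚ) : ℝ)) - z)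
          Qt ≠ 0))
    (r : KZ.IntegralRep 1) (hdom : ∀ v ∈ r.domain, (lo : ℝ) ≤ v 0 ∧ v 0 ≤ hi)
    (hr : EqOn r.integrand (fun v => Polynomial.aeval (v 0) N / Polynomial.aeval (v 0) Q *
      √(qD e f g (v 0))) r.domain) :
    InBaker (KZ.of r) := by
  obtain ⟨Da, hDadef⟩ : ∃ Da : ℚ, Da = e * a ^ 2 + f * a + g := ⟨_, rfl⟩
  obtain ⟨f₁, hf₁def⟩ : ∃ f₁ : ℚ, f₁ = 2 * e * a + f := ⟨_, rfl⟩
  have hDt : ∀ z : ℝ, z ≠ 0 → qD Da f₁ e z = z ^ 2 * qD e f g ((a : ℝ) + z⁻¹) := fun z hz => by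
    rw [hDadef, hf₁def]; simp only [qD]; push_cast; field_simp; ring
  have halo' : (a : ℝ) < lo := by exact_mod_cast halo
  -- the `z`-range of the chart
  have hzrange : ∀ x : ℝ, (lo : ℝ) ≤ x → x ≤ hi →
      ((1 / (hi - a) : ℚ) : ℝ) ≤ (x - a)⁻¹ ∧ (x - a)⁻¹ ≤ ((1 / (lo - a) : ℚ) : ℝ) := by
    intro x hlo hhi
    have hxa : 0 < x - a := by linarith
    have hla : (0 : ℝ) < lo - a := by linarith
    have hha : (0 : ℝ) < hi - a := by linarith
    push_cast
    rw [one_div, one_div]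
    exact ⟨(inv_le_inv₀ hha hxa).2 (by linarith), (inv_le_inv₀ hxa hla).2 (by linarith)⟩
  have hQx : ∀ v ∈ r.domain, Polynomial.aeval ((v 0 - a)⁻¹) Qt ≠ 0 := fun v hv =>
    (hQt _ (hzrange _ (hdom v hv).1 (hdom v hv).2).1 (hzrange _ (hdom v hv).1 (hdom v hv).2).2).1
  refine InBaker.restrict_pos e f g r _ hr fun r₁ hsub hpos hr₁ => ?_
  -- target of the chart: `z > 0`, `D̃(z) > 0`, `Qt(z) ≠ 0`
  obtain ⟨T₀, hT₀def⟩ : ∃ T₀ : Set (Fin 1 → ℝ), T₀ = {v : Fin 1 → ℝ |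
      v ∈ {v : Fin 1 → ℝ | v ∈ {v : Fin 1 → ℝ | 0 < v 0} ∧ 0 < qD Da f₁ e (v 0)} ∧
        Polynomial.aeval (v 0) Qt ≠ 0} := ⟨_, rfl⟩
  have hT₀ : IsSemialgebraic ℚ T₀ := by
    rw [hT₀def]
    exact (IsRatOn.coord.polyAeval Qt).isSemialgebraic_sep_ne_zero
      (IsSemialgebraicFunOn.isSemialgebraic_sep_pos
        (isSemialgebraicFunOn_qD Da f₁ e isSemialgebraic_pos'))
  have hT₀mem : ∀ v, v ∈ T₀ ↔
      0 < v 0 ∧ 0 < qD Da f₁ e (v 0) ∧ Polynomial.aeval (v 0) Qt ≠ 0 := by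
    intro v; rw [hT₀def]; simp only [mem_setOf_eq, and_assoc]
  refine InBaker.of_invert' a r₁ hT₀ (fun v hv => ((hT₀mem v).1 hv).1.ne') (fun x hx => ?_)
    (fun v => v 0 ^ q * Polynomial.aeval (v 0) Nt / (v 0 ^ (n + 3) * Polynomial.aeval (v 0) Qt) *
      √(qD Da f₁ e (v 0))) ?_ (fun v hv hvd => ?_) fun r₃ hd₃ hi₃ => ?_
  · -- the chart covers the domain
    obtain ⟨hlo, hhi⟩ := hdom x (hsub hx)
    have hxa : 0 < x 0 - a := by linarith
    refine ⟨(sub_pos.1 hxa).ne', (hT₀mem _).2 ⟨inv_pos.2 hxa, ?_, hQx x (hsub hx)⟩⟩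
    rw [hDt _ (inv_ne_zero hxa.ne'), inv_inv, show (a : ℝ) + (x 0 - a) = x 0 by ring]
    exact mul_pos (pow_pos (inv_pos.2 hxa) 2) (hpos x hx)
  · -- semialgebraic pull-back
    have h0 : ∀ v ∈ T₀, v 0 ^ (n + 3) * Polynomial.aeval (v 0) Qt ≠ 0 := fun v hv =>
      mul_ne_zero (pow_ne_zero _ ((hT₀mem v).1 hv).1.ne') ((hT₀mem v).1 hv).2.2
    have h1 : IsRatOn T₀ fun v => v 0 ^ q * Polynomial.aeval (v 0) Nt /
        (v 0 ^ (n + 3) * Polynomial.aeval (v 0) Qt) :=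
      ((IsRatOn.coord.pow q).mul (IsRatOn.coord.polyAeval Nt)).div
        ((IsRatOn.coord.pow (n + 3)).mul (IsRatOn.coord.polyAeval Qt)) h0
    exact ((h1.isSemialgebraicFunOn hT₀).mul_holds (IsSemialgebraicFunOn.sqrt_holds
      (isSemialgebraicFunOn_qD Da f₁ e hT₀))).congr fun v _ => by simp only [Pi.mul_apply]
  · -- the pull-back `N(a + 1/z)/Q(a + 1/z)·√D(a + 1/z)/z² = z^q·Nt(z)/(z^(n+3)·Qt(z))·√D̃(z)`
    have hz : (0 : ℝ) < v 0 := ((hT₀mem v).1 hv).1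
    have hQz : Polynomial.aeval (v 0) Qt ≠ 0 := ((hT₀mem v).1 hv).2.2
    have hxa : (a : ℝ) + (v 0)⁻¹ ≠ a := by
      intro h
      exact inv_ne_zero hz.ne' (by linarith)
    rw [hr₁ hvd]
    beta_reduce
    rw [hN _ hxa, hQ _ hxa, show (a : ℝ) + (v 0)⁻¹ - a = (v 0)⁻¹ by ring, inv_inv]
    have hDx : qD e f g ((a : ℝ) + (v 0)⁻¹) = qD Da f₁ e (v 0) / v 0 ^ 2 := by
      rw [hDt _ hz.ne', mul_div_cancel_left₀ _ (pow_ne_zero 2 hz.ne')]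
    rw [hDx, Real.sqrt_div' _ (sq_nonneg _), Real.sqrt_sq hz.le, inv_pow, inv_pow]
    have hz0 : v 0 ≠ 0 := hz.ne'
    field_simp
    ring
  · -- the pulled-back representation
    have hmem₃ : ∀ v ∈ r₃.domain, (0 < v 0 ∧ 0 < qD Da f₁ e (v 0) ∧
        Polynomial.aeval (v 0) Qt ≠ 0) ∧ (fun _ : Fin 1 => (a : ℝ) + (v 0)⁻¹) ∈ r₁.domain :=
      fun v hv => by rw [hd₃] at hv; exact ⟨(hT₀mem v).1 hv.1, hv.2⟩
    have hpos₃ : ∀ v ∈ r₃.domain, (0 : ℝ) < v 0 := fun v hv => (hmem₃ v hv).1.1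
    have hQ₃ : ∀ v ∈ r₃.domain, Polynomial.aeval (v 0) Qt ≠ 0 := fun v hv => (hmem₃ v hv).1.2.2
    have hdom₃ : ∀ v ∈ r₃.domain,
        ((1 / (hi - a) : ℚ) : ℝ) ≤ v 0 ∧ v 0 ≤ ((1 / (lo - a) : ℚ) : ℝ) := by
      intro v hv
      obtain ⟨hlo, hhi⟩ := hdom _ (hsub (hmem₃ v hv).2)
      have h := hzrange _ hlo hhi
      rwa [show (a : ℝ) + (v 0)⁻¹ - a = (v 0)⁻¹ by ring, inv_inv] at h
    by_cases hDa : e * a ^ 2 + f * a + g = 0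
    · -- `D(a) = 0`: linear radicand `D′(a)·z + e`, `D′(a) ≠ 0` since `Δ ≠ 0`; ANY rational factor
      have hf₁ : f₁ ≠ 0 := by
        intro h0
        apply hh
        have h4 : g - f ^ 2 / (4 * e) =
            (e * a ^ 2 + f * a + g) - (2 * e * a + f) ^ 2 / (4 * e) := by
          field_simp; ring
        rw [h4, hDa, ← hf₁def, h0]; simp
      have hDa0 : Da = 0 := by rw [hDadef]; exact hDa
      subst hDa0
      exact InBaker.linear_factor f₁ e hf₁ (Polynomial.X ^ q * Nt) (Polynomial.X ^ (n + 3) * Qt)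
        r₃ (fun v hv => by
          simpa only [map_mul, map_pow, Polynomial.aeval_X] using
            mul_ne_zero (pow_ne_zero _ (hpos₃ v hv).ne') (hQ₃ v hv))
        fun v _ => by rw [hi₃]; simp only [map_mul, map_pow, Polynomial.aeval_X]
    · have hDa0 : Da ≠ 0 := by rw [hDadef]; exact hDa
      have hh₁ : e - f₁ ^ 2 / (4 * Da) ≠ 0 := by
        have h4 : e - f₁ ^ 2 / (4 * Da) = (4 * e * Da - f₁ ^ 2) / (4 * Da) := by field_simp
        have h5 : 4 * e * Da - f₁ ^ 2 = 4 * e * (g - f ^ 2 / (4 * e)) := by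
          rw [hDadef, hf₁def]; field_simp; ring
        rw [h4, h5]
        exact div_ne_zero (mul_ne_zero (mul_ne_zero four_ne_zero he) hh)
          (mul_ne_zero four_ne_zero hDa0)
      have hQt' : ∀ z : ℝ, ((1 / (hi - a) : ℚ) : ℝ) ≤ z → z ≤ ((1 / (lo - a) : ℚ) : ℝ) →
          Polynomial.aeval z Qt ≠ 0 ∧
            Polynomial.aeval (2 * (((-f₁ / (2 * Da) : ℚ)) : ℝ) - z) Qt ≠ 0 := by
        intro z h1 h2
        have h := hQt z h1 h2
        rw [hDadef, hf₁def]
        exact ⟨h.1, h.2 hDa⟩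
      have hδ : (0 : ℚ) < 1 / (|hi - a| + 1) := by positivity
      have hsepz : ∀ v ∈ r₃.domain, ((1 / (|hi - a| + 1) : ℚ) : ℝ) ≤ v 0 := by
        intro v hv
        have hz := hpos₃ v hv
        obtain ⟨-, hhi⟩ := hdom _ (hsub (hmem₃ v hv).2)
        have h1 : (v 0)⁻¹ ≤ |(hi : ℝ) - a| + 1 := by linarith [le_abs_self ((hi : ℝ) - a)]
        have h2 : (0 : ℝ) < |(hi : ℝ) - a| + 1 := by positivity
        push_cast
        rw [one_div]
        exact (inv_le_comm₀ h2 hz).2 h1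
      rcases le_or_gt (n + 3) q with hnq | hnq
      · -- `q ≥ n + 3`: a polynomial factor `z^(q − n − 3)·Nt(z)`, no pole
        refine InBaker.rat_factor_mult Da f₁ e hDa0 hh₁ Qt (1 / (hi - a)) (1 / (lo - a))
          (1 / (|hi - a| + 1)) hδ hQt' [] (fun b hb => by simp at hb)
          (Polynomial.X ^ (q - (n + 3)) * Nt) r₃ hdom₃ (fun v _ b hb => by simp at hb)
          fun v hv => ?_
        have hz := (hpos₃ v hv).ne'
        rw [hi₃]
        beta_reduce
        rw [List.map_nil, List.prod_nil, mul_one, map_mul, map_pow, Polynomial.aeval_X,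
          show v 0 ^ q * Polynomial.aeval (v 0) Nt / (v 0 ^ (n + 3) * Polynomial.aeval (v 0) Qt) =
              v 0 ^ (q - (n + 3)) * Polynomial.aeval (v 0) Nt / Polynomial.aeval (v 0) Qt by
            rw [div_eq_div_iff (mul_ne_zero (pow_ne_zero _ hz) (hQ₃ v hv)) (hQ₃ v hv),
              show v 0 ^ q = v 0 ^ (q - (n + 3)) * v 0 ^ (n + 3) by
                rw [← pow_add, Nat.sub_add_cancel hnq]]
            ring]
      · -- `q < n + 3`: a pole of order `n + 3 − q` at `z = 0`, at distance `≥ 1/(|hi − a| + 1)`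
        obtain ⟨k, hk⟩ : ∃ k : ℕ, n + 3 = q + k := ⟨n + 3 - q, by omega⟩
        refine InBaker.rat_factor_mult Da f₁ e hDa0 hh₁ Qt (1 / (hi - a)) (1 / (lo - a))
          (1 / (|hi - a| + 1)) hδ hQt' (List.replicate k 0)
          (fun b hb => by rw [List.eq_of_mem_replicate hb]; exact hQt0)
          Nt r₃ hdom₃ (fun v hv b hb _ => ?_) fun v hv => ?_
        · rw [List.eq_of_mem_replicate hb, Rat.cast_zero, sub_zero, abs_of_pos (hpos₃ v hv)]
          exact hsepz v hv
        · have hz := (hpos₃ v hv).ne'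
          rw [hi₃]
          beta_reduce
          rw [List.map_replicate, List.prod_replicate, Rat.cast_zero, sub_zero, hk, pow_add]
          field_simp

/-- REVERSED TAYLOR EXPANSION at a rational point: `N(x) = (x − a)^deg N · Nt(1/(x − a))` with
`Nt = reflect (deg N) (taylor a N)` (the Taylor coefficients of `N` at `a`, reversed).
[Mathlib `Polynomial.eval₂_reflect_mul_pow`] -/
theorem aeval_eq_pow_mul_aeval_revTaylor (N : Polynomial ℚ) (a : ℚ) (x : ℝ) (hx : x ≠ a) :
    Polynomial.aeval x N = (x - a) ^ N.natDegree *
      Polynomial.aeval (x - a)⁻¹ (Polynomial.reflect N.natDegree (Polynomial.taylor a N)) := by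
  have hxa : x - (a : ℝ) ≠ 0 := sub_ne_zero.2 hx
  letI : Invertible (x - (a : ℝ)) := invertibleOfNonzero hxa
  have h := Polynomial.eval₂_reflect_mul_pow (algebraMap ℚ ℝ) (x - (a : ℝ)) N.natDegree
    (Polynomial.taylor a N) (Polynomial.natDegree_taylor _ _).le
  rw [invOf_eq_inv] at h
  have h2 : Polynomial.eval₂ (algebraMap ℚ ℝ) (x - (a : ℝ)) (Polynomial.taylor a N) =
      Polynomial.aeval x N := by
    rw [Polynomial.taylor_apply, ← Polynomial.aeval_def, Polynomial.aeval_comp]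
    simp
  rw [← h2, ← h, ← Polynomial.aeval_def, mul_comm]

/-- The reversed Taylor polynomial at `0` is the leading coefficient. [Mathlib] -/
theorem eval_zero_revTaylor (Q : Polynomial ℚ) (a : ℚ) :
    (Polynomial.reflect Q.natDegree (Polynomial.taylor a Q)).eval 0 = Q.leadingCoeff := by
  rw [← Polynomial.coeff_zero_eq_eval_zero, Polynomial.coeff_reflect, Polynomial.revAt_zero,
    Polynomial.coeff_taylor_natDegree]

/-- `InBaker.moebius_factor` with the reversed Taylor data taken from Mathlib
(`Qt = reflect (deg Q) (taylor a Q)`, `Qt(0) = lead Q ≠ 0`): for given `N, Q, a` only the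
hull-cleanness of `Qt` on the `z`-range `[1/(hi − a), 1/(lo − a)]` remains to be checked — a
real-root location statement for ONE explicit polynomial. [this node] -/
theorem InBaker.moebius_factor' (e f g a : ℚ) (he : e ≠ 0) (hh : g - f ^ 2 / (4 * e) ≠ 0)
    (N Q : Polynomial ℚ) (hQ0 : Q ≠ 0) (lo hi : ℚ) (halo : a < lo)
    (hQt : ∀ z : ℝ, ((1 / (hi - a) : ℚ) : ℝ) ≤ z → z ≤ ((1 / (lo - a) : ℚ) : ℝ) →
      Polynomial.aeval z (Polynomial.reflect Q.natDegree (Polynomial.taylor a Q)) ≠ 0 ∧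
        (e * a ^ 2 + f * a + g ≠ 0 → Polynomial.aeval
          (2 * (((-(2 * e * a + f) / (2 * (e * a ^ 2 + f * a + g)) : ℚ) : ℝ)) - z)
            (Polynomial.reflect Q.natDegree (Polynomial.taylor a Q)) ≠ 0))
    (r : KZ.IntegralRep 1) (hdom : ∀ v ∈ r.domain, (lo : ℝ) ≤ v 0 ∧ v 0 ≤ hi)
    (hr : EqOn r.integrand (fun v => Polynomial.aeval (v 0) N / Polynomial.aeval (v 0) Q *
      √(qD e f g (v 0))) r.domain) :
    InBaker (KZ.of r) :=
  InBaker.moebius_factor e f g a he hh N Q _ _ N.natDegree Q.natDegree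
    (fun x hx => aeval_eq_pow_mul_aeval_revTaylor N a x hx)
    (fun x hx => aeval_eq_pow_mul_aeval_revTaylor Q a x hx)
    (by rw [eval_zero_revTaylor]; exact Polynomial.leadingCoeff_ne_zero.2 hQ0) lo hi halo hQt r
    hdom hr

end Summit.KontsevichZagierPeriods.RootDecompWalshStrata.ConicDescent
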